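import Summits.QuantumFields.BalabanUV.T4Continuum.Support.NE7K1LinHomGramKernel

/-!
# NE7K1LinHomGramBond — row NE7 (node U5), candidate route HOM, path H1L, cell K1-lin(s): THE GRAM MATRIX OF THE BOND KERNEL
# `Gb(Y,Z) = Σ_t b(t,Y)b(t,Z)` in closed form, and its row sum `L·Σ_Z |Gb(Y,Z)| ≤ (3L³ − 6L + 4)∕L³ ≤ 3`

Lineage `b2b-balaban-t4-ne7-p2` (CRUX PROVER NE7 #2), generation 66 (tenth file; Gram sharpening, bond factor).  The Schur test charged
the bond factor `α₀α₁ = 3·(5∕3) = 5`; its Gram row sum is `3 − 6∕L² + 4∕L³` (lens 2's one-dimensional ratio on the alternating field is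
`ρ(L) = 3 − 6∕(L²+2)`: equal at `L = 2`, within 1% after — the tensor-product lift is near-optimal in one dimension and its constant
`3` is the sharp L-uniform value there).  With `p = [1 ≤ Y]`, `q = [Y+1 < N]`, `q′ = [Y+2 < N]`, `q″ = [Y+3 < N]`, all [folklore]:

* closed forms (linear profiles, Faulhaber to degree 2): `D = Σ_{j<L−1}(ℓ_{j+1} − ℓ_j)² = Σ(r_{j+1} − r_j)² = 2(L−1)(2L−3)∕L³`,
  `E = Σ_{j<L−1}(ℓ_{j+1} − ℓ_j)(r_{j+1} − r_j) = 2(L−1)(L−3)∕L³`.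
* `gramB_three`; **`gramB_diag`** `Gb(Y,Y) = q(D∕2 + (1−ℓ_0)²) + (q′ + pq)ℓ_{L−1}²∕4`; **`gramB_offDiag_one`**
  `Gb(Y,Y+1) = −q′(E∕4 + ℓ_{L−1}(ℓ_0−1))` (`= −q′(L−1)²(L+2)∕(2L⁴)`); **`gramB_offDiag_two`** `Gb(Y,Y+2) = q″ℓ_{L−1}²∕4`; `gramB_far ∕
  _out ∕ _comm`; `gramB_row_core`; **`gramB_row_abs`** `L·Σ_Z|Gb(Y,Z)| ≤ 3`.

HONEST FRAMING: Gaussian `A = 0`, finite boxes, finite real matrices, [folklore]; ONE RG step in `U = 1` gauge; a census ∕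
NEEDS-CONSTANT sharpening of the L-uniform upper two-run constant of `NE7K1LinHomUpper` (`5·(5∕2)^d ↦ 3·(37∕30)^d`), no letter ∕
tag ∕ size of NE7 moves; nothing printed asserted; no `sorry`.  FIXED FINITE T⁴, rung (B)+1; NE7 NOT PRINTED ∕ NOT PROVED; spine 0∕9;
NOT infinite volume, NOT mass gap, NOT Clay.  HONEST DEPENDENCY: continuum YM on T⁴ ⇐ BetaPertH ∧ nine spine estimates (0/9 proved);
BetaPertH ⇐ (D1) ∧ (D4) ∧ CAP+tail; G-an2-4 gates asym, D1 and NE2/3/4.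
-/

noncomputable section

open Finset

namespace Summit.QuantumFields.BalabanUV.T4Continuum.NE7K1LinHomGramBond

open NE7K1LinHomKernel NE7K1LinHomKernelSums NE7K1LinHomKernelBond NE7K1LinHomGramSums NE7K1LinHomGramKernel

/-! ### §2b The Gram matrix of the BOND kernel: `Gb(Y,Z) = Σ_t b(t,Y)b(t,Z)`, row sum `≤ 3∕L` -/

/-- the Gram entry of two columns of the bond kernel (the last fine site carries no bond: its term vanishes by the guard). [folklore] -/
def gramB (N L : ℕ) (Y Z : ℤ) : ℝ := ∑ t ∈ range (N * L), bondF N L t Y * bondF N L t Z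

section Closed

/-- `Σ_{j<m} (6j + c)²` in closed form. [folklore] -/
theorem sum_lin_sq (c : ℝ) (m : ℕ) :
    ∑ j ∈ range m, (6 * (j : ℝ) + c) ^ 2 = 6 * ((m : ℝ) - 1) * m * (2 * m - 1) + 6 * c * m * ((m : ℝ) - 1) + c ^ 2 * m := by
  induction m with
  | zero => simp
  | succ m ih => rw [Finset.sum_range_succ, ih]; push_cast; ring

/-- `Σ_{j<m} (6j + c₁)(6j + c₂)` in closed form. [folklore] -/
theorem sum_lin_mul_lin (c₁ c₂ : ℝ) (m : ℕ) :
    ∑ j ∈ range m, (6 * (j : ℝ) + c₁) * (6 * (j : ℝ) + c₂) =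
      6 * ((m : ℝ) - 1) * m * (2 * m - 1) + 3 * (c₁ + c₂) * m * ((m : ℝ) - 1) + c₁ * c₂ * m := by
  induction m with
  | zero => simp
  | succ m ih => rw [Finset.sum_range_succ, ih]; push_cast; ring

variable {L : ℕ}

/-- `D := Σ_{j<L−1} (ℓ_{j+1} − ℓ_j)² = 2(L−1)(2L−3)∕L³`. [folklore] -/
theorem sum_dL_sq (hL : 1 ≤ L) :
    ∑ j ∈ range (L - 1), (shapeL L ((j : ℤ) + 1) - shapeL L (j : ℤ)) ^ 2 = 2 * ((L : ℝ) - 1) * (2 * L - 3) / (L : ℝ) ^ 3 := by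
  have hL0 : (L : ℝ) ≠ 0 := Nat.cast_ne_zero.2 (by omega)
  have hc : ((L - 1 : ℕ) : ℝ) = (L : ℝ) - 1 := by rw [Nat.cast_sub hL]; simp
  have h : ∀ j ∈ range (L - 1), (shapeL L ((j : ℤ) + 1) - shapeL L (j : ℤ)) ^ 2 = (6 * (j : ℝ) + (6 - 4 * L)) ^ 2 / (L : ℝ) ^ 4 := by
    intro j _; rw [shapeL_succ_sub hL]; push_cast; rw [div_pow]; ring
  rw [Finset.sum_congr rfl h, ← Finset.sum_div, sum_lin_sq, hc]
  field_simp
  ring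

/-- `Σ_{j<L−1} (r_{j+1} − r_j)² = D`. [folklore] -/
theorem sum_dR_sq (hL : 1 ≤ L) :
    ∑ j ∈ range (L - 1), (shapeR L ((j : ℤ) + 1) - shapeR L (j : ℤ)) ^ 2 = 2 * ((L : ℝ) - 1) * (2 * L - 3) / (L : ℝ) ^ 3 := by
  have hL0 : (L : ℝ) ≠ 0 := Nat.cast_ne_zero.2 (by omega)
  have hc : ((L - 1 : ℕ) : ℝ) = (L : ℝ) - 1 := by rw [Nat.cast_sub hL]; simp
  have h : ∀ j ∈ range (L - 1), (shapeR L ((j : ℤ) + 1) - shapeR L (j : ℤ)) ^ 2 = (6 * (j : ℝ) + (6 - 2 * L)) ^ 2 / (L : ℝ) ^ 4 := by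
    intro j _; rw [shapeR_succ_sub hL]; push_cast; rw [div_pow]; ring
  rw [Finset.sum_congr rfl h, ← Finset.sum_div, sum_lin_sq, hc]
  field_simp
  ring

/-- `E := Σ_{j<L−1} (ℓ_{j+1} − ℓ_j)(r_{j+1} − r_j) = 2(L−1)(L−3)∕L³`. [folklore] -/
theorem sum_dL_dR (hL : 1 ≤ L) :
    ∑ j ∈ range (L - 1), (shapeL L ((j : ℤ) + 1) - shapeL L (j : ℤ)) * (shapeR L ((j : ℤ) + 1) - shapeR L (j : ℤ)) =
      2 * ((L : ℝ) - 1) * ((L : ℝ) - 3) / (L : ℝ) ^ 3 := by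
  have hL0 : (L : ℝ) ≠ 0 := Nat.cast_ne_zero.2 (by omega)
  have hc : ((L - 1 : ℕ) : ℝ) = (L : ℝ) - 1 := by rw [Nat.cast_sub hL]; simp
  have h : ∀ j ∈ range (L - 1), (shapeL L ((j : ℤ) + 1) - shapeL L (j : ℤ)) * (shapeR L ((j : ℤ) + 1) - shapeR L (j : ℤ)) =
      (6 * (j : ℝ) + (6 - 4 * L)) * (6 * (j : ℝ) + (6 - 2 * L)) / (L : ℝ) ^ 4 := by
    intro j _; rw [shapeL_succ_sub hL, shapeR_succ_sub hL]; push_cast; field_simp; ring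
  rw [Finset.sum_congr rfl h, ← Finset.sum_div, sum_lin_mul_lin, hc]
  field_simp
  ring

end Closed

section GramB

variable {N L : ℕ}

/-- the bond kernel at a fine site of block `X` vanishes unless `Y ∈ {X−1, X, X+1}`. [folklore] -/
theorem bondF_far (hL : 1 ≤ L) {X Y : ℤ} {j : ℕ} (hX0 : 0 ≤ X) (hXN : X < N) (hjL : j < L)
    (h1 : Y ≠ X - 1) (h2 : Y ≠ X) (h3 : Y ≠ X + 1) : bondF N L (L * X + (j : ℤ)) Y = 0 := by
  by_cases hint : (j : ℤ) + 1 < L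
  · rw [bondF_int_val hX0 hXN (by positivity) hint, if_neg h1, if_neg h2, add_zero]
  · have hj : ((j : ℕ) : ℤ) = ((L - 1 : ℕ) : ℤ) := by omega
    rw [hj]
    by_cases htop : X + 1 < N
    · rw [show ((L - 1 : ℕ) : ℤ) = (L : ℤ) - 1 by omega, bondF_face_val hL hX0 htop, if_neg h1, if_neg h2, if_neg h3,
        add_zero, add_zero]
    · exact bondF_lastOffset_of_top hL htop Y

/-- the Gram entry reduced to the three blocks around column `Y`. [folklore] -/
theorem gramB_three (hL : 1 ≤ L) (Y Z : ℤ) :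
    gramB N L Y Z = ∑ j ∈ range L, bondF N L (L * (Y - 1) + j) Y * bondF N L (L * (Y - 1) + j) Z +
      ∑ j ∈ range L, bondF N L (L * Y + j) Y * bondF N L (L * Y + j) Z +
      ∑ j ∈ range L, bondF N L (L * (Y + 1) + j) Y * bondF N L (L * (Y + 1) + j) Z := by
  unfold gramB
  rw [sum_range_mul (fun t => bondF N L t Y * bondF N L t Z) N L]
  push_cast
  rw [sum_range_cast (fun X => ∑ j ∈ range L, bondF N L (L * X + j) Y * bondF N L (L * X + j) Z) N]
  refine sum_eq_three _ _ Y (fun X hX => ?_) (fun X h1 h2 h3 => ?_)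
  · have hX' : ¬ (0 ≤ X ∧ X < N) := fun h => hX (Finset.mem_image.2 ⟨X.toNat, Finset.mem_range.2 (by omega), by omega⟩)
    exact Finset.sum_eq_zero fun j hj => by rw [bondF_of_not_mem (not_mem_bond hX' (Finset.mem_range.1 hj)) Y, zero_mul]
  · by_cases hX : 0 ≤ X ∧ X < N
    · exact Finset.sum_eq_zero fun j hj => by
        rw [bondF_far hL hX.1 hX.2 (Finset.mem_range.1 hj) (by omega) (by omega) (by omega), zero_mul]
    · exact Finset.sum_eq_zero fun j hj => by rw [bondF_of_not_mem (not_mem_bond hX (Finset.mem_range.1 hj)) Y, zero_mul]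

/-- a block of the bond Gram sum vanishes when the block is not a neighbour of the second column. [folklore] -/
theorem gramB_block_zero_right (hL : 1 ≤ L) {Y Z X : ℤ} (h : X ≠ Z - 1 ∧ X ≠ Z ∧ X ≠ Z + 1) :
    ∑ j ∈ range L, bondF N L (L * X + j) Y * bondF N L (L * X + j) Z = 0 := by
  refine Finset.sum_eq_zero fun j hj => ?_
  by_cases hX : 0 ≤ X ∧ X < N
  · rw [bondF_far hL (Y := Z) hX.1 hX.2 (Finset.mem_range.1 hj) (by omega) (by omega) (by omega), mul_zero]
  · rw [bondF_of_not_mem (not_mem_bond hX (Finset.mem_range.1 hj)) Z, mul_zero]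

/-- the bond Gram entry vanishes three or more columns away. [folklore] -/
theorem gramB_far (hL : 1 ≤ L) {Y Z : ℤ} (h : Z + 3 ≤ Y ∨ Y + 3 ≤ Z) : gramB N L Y Z = 0 := by
  rw [gramB_three hL, gramB_block_zero_right hL ⟨by omega, by omega, by omega⟩,
    gramB_block_zero_right hL (X := Y) ⟨by omega, by omega, by omega⟩,
    gramB_block_zero_right hL (X := Y + 1) ⟨by omega, by omega, by omega⟩, add_zero, add_zero]

/-- the bond kernel vanishes at coarse labels outside the segment. [folklore] -/
theorem bondF_col_out (t : ℤ) {Y : ℤ} (hY : ¬ (0 ≤ Y ∧ Y < N)) : bondF N L t Y = 0 := by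
  unfold bondF
  split_ifs with ht
  · have hN : (1 : ℤ) ≤ N := by
      by_contra h
      have : (N : ℤ) * L ≤ 0 := by nlinarith
      omega
    rcases lt_or_ge Y 0 with h | h
    · rw [cumF_of_neg _ h, cumF_of_neg _ h, sub_self]
    · rw [cumF_of_last_le _ (by omega) (by omega), cumF_of_last_le _ (by omega) (by omega), sub_self]
  · rfl

/-- the bond Gram entry vanishes at labels outside the segment. [folklore] -/
theorem gramB_out {Y Z : ℤ} (hZ : ¬ (0 ≤ Z ∧ Z < N)) : gramB N L Y Z = 0 := by
  unfold gramB
  exact Finset.sum_eq_zero fun t _ => by rw [bondF_col_out _ hZ, mul_zero]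

/-- the bond Gram matrix is symmetric. [folklore] -/
theorem gramB_comm (Y Z : ℤ) : gramB N L Y Z = gramB N L Z Y := by
  unfold gramB
  exact Finset.sum_congr rfl fun t _ => mul_comm _ _

/-- **THE DIAGONAL BOND GRAM ENTRY**: `Gb(Y,Y) = q·(D∕2 + (1−ℓ_0)²) + (q′ + pq)·ℓ_{L−1}²∕4`. [folklore] -/
theorem gramB_diag (hL : 1 ≤ L) {Y : ℤ} (hY0 : 0 ≤ Y) (hYN : Y < N) :
    gramB N L Y Y =
      (if Y + 1 < N then (1 : ℝ) else 0) * ((2 * ((L : ℝ) - 1) * (2 * L - 3) / (L : ℝ) ^ 3) / 2 + (1 - shapeL L 0) ^ 2) +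
      ((if Y + 2 < N then (1 : ℝ) else 0) + (if 1 ≤ Y then (1 : ℝ) else 0) * (if Y + 1 < N then (1 : ℝ) else 0)) *
        (shapeL L ((L : ℤ) - 1) ^ 2 / 4) := by
  have ecast : ((L - 1 : ℕ) : ℤ) = (L : ℤ) - 1 := by omega
  rw [gramB_three hL]
  set p : ℝ := if 1 ≤ Y then (1 : ℝ) else 0 with hp
  set q : ℝ := if Y + 1 < N then (1 : ℝ) else 0 with hq
  set q' : ℝ := if Y + 2 < N then (1 : ℝ) else 0 with hq'
  have hq2 : q * q = q := by rcases ite_zero_or_one (Y + 1 < (N : ℤ)) with h | h <;> rw [hq, h] <;> norm_num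
  have hq'2 : q' * q' = q' := by rcases ite_zero_or_one (Y + 2 < (N : ℤ)) with h | h <;> rw [hq', h] <;> norm_num
  -- block Y − 1: only the face, value `−q ℓ_{L−1}/2`, present iff `1 ≤ Y`
  have h1 : ∑ j ∈ range L, bondF N L (L * (Y - 1) + j) Y * bondF N L (L * (Y - 1) + j) Y =
      p * q * (shapeL L ((L : ℤ) - 1) ^ 2 / 4) := by
    by_cases hY1 : 1 ≤ Y
    · rw [hp, if_pos hY1, one_mul, sum_range_split_last hL]
      have hint : ∑ j ∈ range (L - 1), bondF N L (L * (Y - 1) + (j : ℕ)) Y * bondF N L (L * (Y - 1) + (j : ℕ)) Y = 0 := by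
        refine Finset.sum_eq_zero fun j hj => ?_
        have hjL := Finset.mem_range.1 hj
        rw [bondF_int_val (X := Y - 1) (by omega) (by omega) (by positivity) (by omega), if_neg (show ¬ Y = Y - 1 - 1 by omega),
          if_neg (show ¬ Y = Y - 1 by omega), add_zero, zero_mul]
      rw [hint, zero_add, ecast, bondF_face_val hL (X := Y - 1) (by omega) (by omega), if_neg (show ¬ Y = Y - 1 - 1 by omega),
        if_neg (show ¬ Y = Y - 1 by omega), if_pos (show Y = Y - 1 + 1 by ring), zero_add, zero_add,
        show (if Y - 1 + 2 < (N : ℤ) then (1 : ℝ) else 0) = q by rw [hq]; congr 1; simp only [eq_iff_iff]; omega]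
      have : (-(q * (shapeL L ((L : ℤ) - 1) / 2))) * (-(q * (shapeL L ((L : ℤ) - 1) / 2))) =
          q * q * (shapeL L ((L : ℤ) - 1) ^ 2 / 4) := by ring
      rw [this, hq2]
    · rw [hp, if_neg hY1]
      simp only [zero_mul]
      exact Finset.sum_eq_zero fun j hj => by
        rw [bondF_of_not_mem (not_mem_bond (X := Y - 1) (by omega) (Finset.mem_range.1 hj)) Y, zero_mul]
  -- block Y: interior `(−q Δr_j/2)²`, face `q (ℓ_0 − 1)²`
  have h2 : ∑ j ∈ range L, bondF N L (L * Y + j) Y * bondF N L (L * Y + j) Y =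
      q * ((2 * ((L : ℝ) - 1) * (2 * L - 3) / (L : ℝ) ^ 3) / 4) + q * (1 - shapeL L 0) ^ 2 := by
    rw [sum_range_split_last hL]
    have hint : ∑ j ∈ range (L - 1), bondF N L (L * Y + (j : ℕ)) Y * bondF N L (L * Y + (j : ℕ)) Y =
        q * ((2 * ((L : ℝ) - 1) * (2 * L - 3) / (L : ℝ) ^ 3) / 4) := by
      have h : ∀ j ∈ range (L - 1), bondF N L (L * Y + (j : ℕ)) Y * bondF N L (L * Y + (j : ℕ)) Y =
          q * ((shapeR L ((j : ℤ) + 1) - shapeR L (j : ℤ)) ^ 2 / 4) := by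
        intro j hj
        have hjL := Finset.mem_range.1 hj
        rw [bondF_int_val hY0 hYN (by positivity) (by omega), if_neg (show ¬ Y = Y - 1 by omega), if_pos rfl, zero_add, ← hq]
        have : (-(q * ((shapeR L ((j : ℤ) + 1) - shapeR L (j : ℤ)) / 2))) * (-(q * ((shapeR L ((j : ℤ) + 1) - shapeR L (j : ℤ)) / 2))) =
            q * q * ((shapeR L ((j : ℤ) + 1) - shapeR L (j : ℤ)) ^ 2 / 4) := by ring
        rw [this, hq2]
      rw [Finset.sum_congr rfl h, ← Finset.mul_sum, ← Finset.sum_div, sum_dR_sq hL]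
    rw [hint]
    by_cases htop : Y + 1 < N
    · rw [ecast, bondF_face_val hL hY0 htop, if_neg (show ¬ Y = Y - 1 by omega), if_pos rfl, if_neg (show ¬ Y = Y + 1 by omega),
        zero_add, add_zero, hq, if_pos htop]
      ring
    · rw [bondF_lastOffset_of_top hL htop, hq, if_neg htop]
      ring
  -- block Y + 1: interior `(Δℓ_j/2)²`, face `(q′ ℓ_{L−1}/2)²`, present iff `Y + 1 < N`
  have h3 : ∑ j ∈ range L, bondF N L (L * (Y + 1) + j) Y * bondF N L (L * (Y + 1) + j) Y =
      q * ((2 * ((L : ℝ) - 1) * (2 * L - 3) / (L : ℝ) ^ 3) / 4) + q' * (shapeL L ((L : ℤ) - 1) ^ 2 / 4) := by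
    by_cases hY1 : Y + 1 < N
    · rw [hq, if_pos hY1, one_mul, sum_range_split_last hL]
      have hint : ∑ j ∈ range (L - 1), bondF N L (L * (Y + 1) + (j : ℕ)) Y * bondF N L (L * (Y + 1) + (j : ℕ)) Y =
          (2 * ((L : ℝ) - 1) * (2 * L - 3) / (L : ℝ) ^ 3) / 4 := by
        have h : ∀ j ∈ range (L - 1), bondF N L (L * (Y + 1) + (j : ℕ)) Y * bondF N L (L * (Y + 1) + (j : ℕ)) Y =
            (shapeL L ((j : ℤ) + 1) - shapeL L (j : ℤ)) ^ 2 / 4 := by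
          intro j hj
          have hjL := Finset.mem_range.1 hj
          rw [bondF_int_val (X := Y + 1) (by omega) hY1 (by positivity) (by omega), if_pos (show Y = Y + 1 - 1 by ring),
            if_neg (show ¬ Y = Y + 1 by omega), add_zero, if_pos (show (1 : ℤ) ≤ Y + 1 by omega)]
          ring
        rw [Finset.sum_congr rfl h, ← Finset.sum_div, sum_dL_sq hL]
      rw [hint]
      by_cases htop : Y + 1 + 1 < N
      · rw [ecast, bondF_face_val hL (X := Y + 1) (by omega) htop, if_pos (show Y = Y + 1 - 1 by ring),
          if_neg (show ¬ Y = Y + 1 by omega), if_neg (show ¬ Y = Y + 1 + 1 by omega), add_zero, add_zero,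
          if_pos (show (1 : ℤ) ≤ Y + 1 by omega), hq', if_pos (show Y + 2 < (N : ℤ) by omega)]
        ring
      · rw [bondF_lastOffset_of_top hL htop, hq', if_neg (show ¬ (Y + 2 < (N : ℤ)) by omega)]
        ring
    · rw [hq, if_neg hY1, hq', if_neg (show ¬ (Y + 2 < (N : ℤ)) by omega)]
      simp only [zero_mul, add_zero]
      exact Finset.sum_eq_zero fun j hj => by
        rw [bondF_of_not_mem (not_mem_bond (X := Y + 1) (by omega) (Finset.mem_range.1 hj)) Y, zero_mul]
  rw [h1, h2, h3]
  ring

/-- **THE FIRST OFF-DIAGONAL BOND GRAM ENTRY**: `Gb(Y,Y+1) = −q′·(E∕4 + ℓ_{L−1}(ℓ_0 − 1))`, `q′ = [Y+2 < N]` (`Y + 1 < N`). [folklore] -/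
theorem gramB_offDiag_one (hL : 1 ≤ L) {Y : ℤ} (hY0 : 0 ≤ Y) (hYN : Y + 1 < N) :
    gramB N L Y (Y + 1) = -((if Y + 2 < N then (1 : ℝ) else 0) *
      ((2 * ((L : ℝ) - 1) * ((L : ℝ) - 3) / (L : ℝ) ^ 3) / 4 + shapeL L ((L : ℤ) - 1) * (shapeL L 0 - 1))) := by
  have ecast : ((L - 1 : ℕ) : ℤ) = (L : ℤ) - 1 := by omega
  rw [gramB_three hL, gramB_block_zero_right hL ⟨by omega, by omega, by omega⟩, zero_add]
  set q' : ℝ := if Y + 2 < N then (1 : ℝ) else 0 with hq'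
  -- block Y: interior products vanish (second factor), face `(ℓ_0 − 1)·(−q′ ℓ_{L−1}/2)`
  have h2 : ∑ j ∈ range L, bondF N L (L * Y + j) Y * bondF N L (L * Y + j) (Y + 1) =
      -(q' * (shapeL L ((L : ℤ) - 1) * (shapeL L 0 - 1) / 2)) := by
    rw [sum_range_split_last hL]
    have hint : ∑ j ∈ range (L - 1), bondF N L (L * Y + (j : ℕ)) Y * bondF N L (L * Y + (j : ℕ)) (Y + 1) = 0 := by
      refine Finset.sum_eq_zero fun j hj => ?_
      have hjL := Finset.mem_range.1 hj
      rw [bondF_int_val (Y := Y + 1) hY0 (by omega) (by positivity) (by omega), if_neg (show ¬ Y + 1 = Y - 1 by omega),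
        if_neg (show ¬ Y + 1 = Y by omega), add_zero, mul_zero]
    rw [hint, zero_add, ecast, bondF_face_val hL hY0 hYN, bondF_face_val hL hY0 hYN, if_neg (show ¬ Y = Y - 1 by omega), if_pos rfl,
      if_neg (show ¬ Y = Y + 1 by omega), if_neg (show ¬ Y + 1 = Y - 1 by omega), if_neg (show ¬ Y + 1 = Y by omega), if_pos rfl,
      ← hq']
    ring
  -- block Y + 1: interior `(Δℓ_j/2)(−q′ Δr_j/2)`, face `(−q′ℓ_{L−1}/2)(q′(ℓ_0 − 1))`
  have h3 : ∑ j ∈ range L, bondF N L (L * (Y + 1) + j) Y * bondF N L (L * (Y + 1) + j) (Y + 1) =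
      -(q' * ((2 * ((L : ℝ) - 1) * ((L : ℝ) - 3) / (L : ℝ) ^ 3) / 4)) - q' * (shapeL L ((L : ℤ) - 1) * (shapeL L 0 - 1) / 2) := by
    have hq'2 : q' * q' = q' := by rcases ite_zero_or_one (Y + 2 < (N : ℤ)) with h | h <;> rw [hq', h] <;> norm_num
    rw [sum_range_split_last hL]
    have hint : ∑ j ∈ range (L - 1), bondF N L (L * (Y + 1) + (j : ℕ)) Y * bondF N L (L * (Y + 1) + (j : ℕ)) (Y + 1) =
        -(q' * ((2 * ((L : ℝ) - 1) * ((L : ℝ) - 3) / (L : ℝ) ^ 3) / 4)) := by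
      have h : ∀ j ∈ range (L - 1), bondF N L (L * (Y + 1) + (j : ℕ)) Y * bondF N L (L * (Y + 1) + (j : ℕ)) (Y + 1) =
          -(q' * ((shapeL L ((j : ℤ) + 1) - shapeL L (j : ℤ)) * (shapeR L ((j : ℤ) + 1) - shapeR L (j : ℤ)) / 4)) := by
        intro j hj
        have hjL := Finset.mem_range.1 hj
        rw [bondF_int_val (X := Y + 1) (Y := Y) (by omega) hYN (by positivity) (by omega),
          bondF_int_val (X := Y + 1) (Y := Y + 1) (by omega) hYN (by positivity) (by omega),
          if_pos (show Y = Y + 1 - 1 by ring), if_neg (show ¬ Y = Y + 1 by omega), if_neg (show ¬ Y + 1 = Y + 1 - 1 by omega),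
          if_pos rfl, add_zero, zero_add, if_pos (show (1 : ℤ) ≤ Y + 1 by omega),
          show (if Y + 1 + 1 < (N : ℤ) then (1 : ℝ) else 0) = q' by rw [hq']; congr 1; simp only [eq_iff_iff]; omega]
        ring
      rw [Finset.sum_congr rfl h, Finset.sum_neg_distrib, ← Finset.mul_sum, ← Finset.sum_div, sum_dL_dR hL]
    rw [hint]
    by_cases htop : Y + 1 + 1 < N
    · rw [ecast, bondF_face_val hL (X := Y + 1) (Y := Y) (by omega) htop, bondF_face_val hL (X := Y + 1) (Y := Y + 1) (by omega) htop,
        if_pos (show Y = Y + 1 - 1 by ring), if_neg (show ¬ Y = Y + 1 by omega), if_neg (show ¬ Y = Y + 1 + 1 by omega),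
        if_neg (show ¬ Y + 1 = Y + 1 - 1 by omega), if_pos rfl, if_neg (show ¬ Y + 1 = Y + 1 + 1 by omega),
        add_zero, add_zero, zero_add, add_zero, if_pos (show (1 : ℤ) ≤ Y + 1 by omega), hq', if_pos (show Y + 2 < (N : ℤ) by omega)]
      ring
    · rw [bondF_lastOffset_of_top hL htop, zero_mul, add_zero, hq', if_neg (show ¬ (Y + 2 < (N : ℤ)) by omega)]
      ring
  rw [h2, h3]
  ring

/-- **THE SECOND OFF-DIAGONAL BOND GRAM ENTRY**: `Gb(Y,Y+2) = [Y+3 < N]·ℓ_{L−1}²∕4` (`Y + 2 < N`). [folklore] -/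
theorem gramB_offDiag_two (hL : 1 ≤ L) {Y : ℤ} (hY0 : 0 ≤ Y) (hYN : Y + 2 < N) :
    gramB N L Y (Y + 2) = (if Y + 3 < N then (1 : ℝ) else 0) * (shapeL L ((L : ℤ) - 1) ^ 2 / 4) := by
  have ecast : ((L - 1 : ℕ) : ℤ) = (L : ℤ) - 1 := by omega
  rw [gramB_three hL, gramB_block_zero_right hL ⟨by omega, by omega, by omega⟩,
    gramB_block_zero_right hL (X := Y) (Z := Y + 2) ⟨by omega, by omega, by omega⟩, zero_add, zero_add, sum_range_split_last hL]
  have hint : ∑ j ∈ range (L - 1), bondF N L (L * (Y + 1) + (j : ℕ)) Y * bondF N L (L * (Y + 1) + (j : ℕ)) (Y + 2) = 0 := by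
    refine Finset.sum_eq_zero fun j hj => ?_
    have hjL := Finset.mem_range.1 hj
    rw [bondF_int_val (X := Y + 1) (Y := Y + 2) (by omega) (by omega) (by positivity) (by omega),
      if_neg (show ¬ Y + 2 = Y + 1 - 1 by omega), if_neg (show ¬ Y + 2 = Y + 1 by omega), add_zero, mul_zero]
  rw [hint, zero_add, ecast, bondF_face_val hL (X := Y + 1) (Y := Y) (by omega) (by omega),
    bondF_face_val hL (X := Y + 1) (Y := Y + 2) (by omega) (by omega),
    if_pos (show Y = Y + 1 - 1 by ring), if_neg (show ¬ Y = Y + 1 by omega), if_neg (show ¬ Y = Y + 1 + 1 by omega),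
    if_neg (show ¬ Y + 2 = Y + 1 - 1 by omega), if_neg (show ¬ Y + 2 = Y + 1 by omega), if_pos (show Y + 2 = Y + 1 + 1 by ring),
    add_zero, add_zero, zero_add, zero_add, if_pos (show (1 : ℤ) ≤ Y + 1 by omega),
    show (if Y + 1 + 2 < (N : ℤ) then (1 : ℝ) else 0) = (if Y + 3 < (N : ℤ) then (1 : ℝ) else 0) by congr 1; simp only [eq_iff_iff]; omega]
  rcases ite_zero_or_one (Y + 3 < (N : ℤ)) with h | h <;> rw [h] <;> ring

/-- the core of the bond Gram row bound: monotonicity in the indicators. [folklore] -/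
theorem gramB_row_core {p q q' q'' p'' D F G H : ℝ} (hp : p = 0 ∨ p = 1) (hq : q = 0 ∨ q = 1) (hq' : q' = 0 ∨ q' = 1)
    (hq'' : q'' = 0 ∨ q'' = 1) (hp'' : p'' = 0 ∨ p'' = 1) (hD : 0 ≤ D) (hF : 0 ≤ F) (hG : 0 ≤ G) (hH : 0 ≤ H) :
    p'' * q * F + p * q * H + (q * (D / 2 + G) + (q' + p * q) * F) + q' * H + q'' * F ≤ D / 2 + G + 4 * F + 2 * H := by
  rcases hp with rfl | rfl <;> rcases hq with rfl | rfl <;> rcases hq' with rfl | rfl <;> rcases hq'' with rfl | rfl <;>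
    rcases hp'' with rfl | rfl <;> norm_num <;> nlinarith

/-- **THE BOND GRAM ROW BOUND**: `L·Σ_Z |Gb(Y,Z)| ≤ (3L³ − 6L + 4)∕L³ ≤ 3` at every coarse site — the Schur product `α₀α₁ = 5`
replaced by the sharp value (`3 − 6∕L² + 4∕L³`; lens 2's 1-D ratio is `3 − 6∕(L²+2)`). [folklore] -/
theorem gramB_row_abs (hL : 1 ≤ L) {Y : ℤ} (hY0 : 0 ≤ Y) (hYN : Y < N) :
    (L : ℝ) * ∑ Z ∈ range N, |gramB N L Y Z| ≤ 3 := by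
  have hLr : (1 : ℝ) ≤ L := by exact_mod_cast hL
  have hL0 : (L : ℝ) ≠ 0 := by positivity
  set D : ℝ := 2 * ((L : ℝ) - 1) * (2 * L - 3) / (L : ℝ) ^ 3 with hDdef
  set F : ℝ := shapeL L ((L : ℤ) - 1) ^ 2 / 4 with hFdef
  set G : ℝ := (1 - shapeL L 0) ^ 2 with hGdef
  set H : ℝ := (2 * ((L : ℝ) - 1) * ((L : ℝ) - 3) / (L : ℝ) ^ 3) / 4 + shapeL L ((L : ℤ) - 1) * (shapeL L 0 - 1) with hHdef
  have hD : 0 ≤ D := by rw [hDdef, ← sum_dL_sq hL]; exact Finset.sum_nonneg fun _ _ => sq_nonneg _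
  have hF : 0 ≤ F := by rw [hFdef]; positivity
  have hG : 0 ≤ G := by rw [hGdef]; positivity
  have hHval : H = ((L : ℝ) - 1) ^ 2 * (L + 2) / (2 * (L : ℝ) ^ 4) := by
    rw [hHdef, shapeL_last hL, show shapeL L 0 - 1 = -((2 * (L : ℝ) - 1) / (L : ℝ) ^ 2) by rw [← one_sub_shapeL_zero hL]; ring]
    field_simp; ring
  have hH : 0 ≤ H := by rw [hHval]; positivity
  rw [sum_range_cast (fun Z => |gramB N L Y Z|) N]
  have hfar : ∀ Z : ℤ, Z ≠ Y - 2 → Z ≠ Y - 1 → Z ≠ Y → Z ≠ Y + 1 → Z ≠ Y + 2 → gramB N L Y Z = 0 :=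
    fun Z h1 h2 h3 h4 h5 => gramB_far hL (by omega)
  set p : ℝ := if 1 ≤ Y then (1 : ℝ) else 0 with hp
  set q : ℝ := if Y + 1 < N then (1 : ℝ) else 0 with hq
  set q' : ℝ := if Y + 2 < N then (1 : ℝ) else 0 with hq'
  set q'' : ℝ := if Y + 3 < N then (1 : ℝ) else 0 with hq''
  set p'' : ℝ := if 2 ≤ Y then (1 : ℝ) else 0 with hp''
  have v0 : |gramB N L Y Y| = q * (D / 2 + G) + (q' + p * q) * F := by
    rw [gramB_diag hL hY0 hYN, ← hq, ← hq', ← hp, ← hDdef, ← hFdef, ← hGdef, abs_of_nonneg]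
    rcases ite_zero_or_one (1 ≤ Y) with h1 | h1 <;> rcases ite_zero_or_one (Y + 1 < (N : ℤ)) with h2 | h2 <;>
      rcases ite_zero_or_one (Y + 2 < (N : ℤ)) with h3 | h3 <;> rw [hp, hq, hq', h1, h2, h3] <;> positivity
  have v1 : |gramB N L Y (Y + 1)| = q' * H := by
    by_cases h : Y + 1 < N
    · rw [gramB_offDiag_one hL hY0 h, ← hq', ← hHdef, abs_neg, abs_of_nonneg]
      rcases ite_zero_or_one (Y + 2 < (N : ℤ)) with h3 | h3 <;> rw [hq', h3] <;> positivity
    · rw [gramB_out (by omega), hq', if_neg (by omega)]; simp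
  have v2 : |gramB N L Y (Y + 2)| = q'' * F := by
    by_cases h : Y + 2 < N
    · rw [gramB_offDiag_two hL hY0 h, ← hq'', ← hFdef, abs_of_nonneg]
      rcases ite_zero_or_one (Y + 3 < (N : ℤ)) with h3 | h3 <;> rw [hq'', h3] <;> positivity
    · rw [gramB_out (by omega), hq'', if_neg (by omega)]; simp
  have vm1 : |gramB N L Y (Y - 1)| = p * q * H := by
    by_cases h : 1 ≤ Y
    · have hg := gramB_offDiag_one hL (N := N) (Y := Y - 1) (by omega) (by omega)
      rw [show Y - 1 + 1 = Y by ring, show Y - 1 + 2 = Y + 1 by ring] at hg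
      rw [gramB_comm, hg, ← hq, ← hHdef, hp, if_pos h, one_mul, abs_neg, abs_of_nonneg]
      rcases ite_zero_or_one (Y + 1 < (N : ℤ)) with h3 | h3 <;> rw [hq, h3] <;> positivity
    · rw [gramB_out (by omega), hp, if_neg h]; simp
  have vm2 : |gramB N L Y (Y - 2)| = p'' * q * F := by
    by_cases h : 2 ≤ Y
    · have hg := gramB_offDiag_two hL (N := N) (Y := Y - 2) (by omega) (by omega)
      rw [show Y - 2 + 2 = Y by ring, show Y - 2 + 3 = Y + 1 by ring] at hg
      rw [gramB_comm, hg, ← hq, ← hFdef, hp'', if_pos h, one_mul, abs_of_nonneg]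
      rcases ite_zero_or_one (Y + 1 < (N : ℤ)) with h3 | h3 <;> rw [hq, h3] <;> positivity
    · rw [gramB_out (by omega), hp'', if_neg h]; simp
  have core := gramB_row_core (D := D) (F := F) (G := G) (H := H) (ite_zero_or_one (1 ≤ Y)) (ite_zero_or_one (Y + 1 < (N : ℤ)))
    (ite_zero_or_one (Y + 2 < (N : ℤ))) (ite_zero_or_one (Y + 3 < (N : ℤ))) (ite_zero_or_one (2 ≤ Y)) hD hF hG hH
  rw [← hp, ← hq, ← hq', ← hq'', ← hp''] at core
  have htot : D / 2 + G + 4 * F + 2 * H = (3 * (L : ℝ) ^ 3 - 6 * L + 4) / (L : ℝ) ^ 4 := by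
    rw [hHval, hDdef, hFdef, hGdef, shapeL_last hL, one_sub_shapeL_zero hL]
    field_simp; ring
  calc (L : ℝ) * ∑ Z ∈ (range N).image (Nat.cast : ℕ → ℤ), |gramB N L Y Z|
      ≤ (L : ℝ) * (|gramB N L Y (Y - 2)| + |gramB N L Y (Y - 1)| + |gramB N L Y Y| + |gramB N L Y (Y + 1)| + |gramB N L Y (Y + 2)|) :=
        mul_le_mul_of_nonneg_left (sum_abs_le_five _ _ Y hfar) (by positivity)
    _ ≤ (L : ℝ) * (D / 2 + G + 4 * F + 2 * H) := by
        rw [v0, v1, v2, vm1, vm2]; exact mul_le_mul_of_nonneg_left core (by positivity)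
    _ = (3 * (L : ℝ) ^ 3 - 6 * L + 4) / (L : ℝ) ^ 3 := by rw [htot]; field_simp
    _ ≤ 3 := by rw [div_le_iff₀ (by positivity)]; nlinarith

end GramB


end Summit.QuantumFields.BalabanUV.T4Continuum.NE7K1LinHomGramBond
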